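import Summits.AtomisticToContinuum.HydrodynamicLimit.Theorems.RelayRaceLocalityLightConeInLawCSRLine
import Summits.AtomisticToContinuum.HydrodynamicLimit.Theorems.RelayRaceLocalityNearConstantShortTimeHLStaticLLN
import Summits.AtomisticToContinuum.HydrodynamicLimit.Theorems.RelayRaceLocalityLightConeInLawStubProfileId

/-!
# Stub `stub_activityGauge` of the line `count-sufficiency-reduction` for the crux `LightConeInLaw`
(stmt-AtomisticToContinuum-12500; route `RelayRaceLocality`, sub-problem `HydrodynamicLimit`)

**Activity gauge (statics).** Two canonical hard-sphere gases with the SAME diameters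
`hsDiameter σ₁ N` — gas 1: `N + 1` spheres with one-body profile `(a₁, u₁, θ₁)` and law
`localGibbsLaw σ₁ a₁ u₁ θ₁ N (Φ₁ N)`; gas 2: `n₂ N` spheres, `n₂ N · ε_N³ → σ₂³`, profile
`(a₂, u₂, θ₂)`. If their time-`0` empirical fields satisfy laws of large numbers (`LLNAt … 0`)
towards continuous densities `ρ₁`, `ρ₂` whose REDUCED densities agree on the ball `B(x₀, R)`
(`ρ₁ σ₁³ = ρ₂ σ₂³` there), then the activities are gauge-equivalent on that ball: `a₁ = λ a₂`
for a constant `λ > 0`.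

Proof. The static law of large numbers with explicit activity inversion
`NearConstantShortTimeHL.staticLLN_explicit` (Pulvirenti–Tsagkarogiannis, canonical cluster
expansion) is applied twice — gas 1 along the family `(hsDiameter σ₁ N, N + 1)` at `σ = σ₁`
(`(N+1) ε_N³ = σ₁³`, `succ_mul_hsDiameter_pow_three`), gas 2 along `(hsDiameter σ₁ N, n₂ N)` at
`σ = σ₂` — below the minimum of the two thresholds. It yields continuous positive `ρaᵢ` with
`aᵢ = e^{cᵢ} ρaᵢ e^{g(ρaᵢ σᵢ³)}` and the density LLN towards `ρaᵢ` under the SAME laws; limits in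
probability are unique (`ProfileId.eq_of_tendsto_measure_lt_abs_sub`), so `∫ χ ρᵢ = ∫ χ ρaᵢ` for
every continuous `χ`, whence `ρᵢ = ρaᵢ` (`ProfileId.eq_of_forall_integral_mul_eq`). On the ball
the arguments `ρa₁ σ₁³ = ρa₂ σ₂³` of `g` coincide, so `a₁ / a₂ = e^{c₁ - c₂} (σ₂ / σ₁)³`.
-/

namespace Summit.AtomisticToContinuum.HydrodynamicLimit.Theorems.LightConeInLawCSR

open scoped BigOperators Topology Classical ENNReal ProbabilityTheory
open Filter Set MeasureTheory ProbabilityTheory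
open Literature.MathematicalPhysics.KineticTheory Literature.Analysis.FluidPDE
open Summit.AtomisticToContinuum.HydrodynamicLimit.Theorems.LightConeInLawSketch
open Summit.AtomisticToContinuum.HydrodynamicLimit.Theorems.LightConeInLawCSR

noncomputable section

/-- **Density identification.** If the density component of a time-`0` law of large numbers
`LLNAt n P Φ ρ U Θ 0` holds under probability measures `P N`, and the empirical density field at
flow-time `0` also converges in probability (under the same laws) to `∫ χ ρa` for every
continuous `χ`, then `ρ = ρa` pointwise (both continuous): limits in probability are unique and
continuous functions with equal integrals against all continuous test functions coincide. -/
theorem density_eq_of_llnAt {n : ℕ → ℕ} {ε : ℕ → ℝ}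
    {P : (N : ℕ) → Measure (Config (n N) (Fin 3) T3)} (hP : ∀ N, IsProbabilityMeasure (P N))
    {Φ : (N : ℕ) → HardSphereFlow G3 (ε N) (n N)} {ρ ρa : T3 → ℝ} {U : T3 → V3} {Θ : T3 → ℝ}
    (hρ : Continuous ρ) (hρa : Continuous ρa) (hL : LLNAt n P Φ ρ U Θ 0)
    (hLa : ∀ χ : T3 → ℝ, Continuous χ → ∀ δ : ℝ, 0 < δ →
      Tendsto (fun N => P N {z | δ < |empiricalDensityField ((Φ N).flow 0 z) χ - ∫ x, χ x * ρa x|})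
        atTop (𝓝 0)) (x : T3) :
    ρ x = ρa x := by
  haveI := hP
  refine ProfileId.eq_of_forall_integral_mul_eq hρ hρa (fun χ hχ => ?_) x
  exact ProfileId.eq_of_tendsto_measure_lt_abs_sub P
    (fun N z => empiricalDensityField ((Φ N).flow 0 z) χ)
    (fun δ hδ => (hL χ hχ δ hδ).1) (fun δ hδ => hLa χ hχ δ hδ)

/-- **Gauge algebra.** If `a₁ = e^{c₁} r₁ g`, `a₂ = e^{c₂} r₂ g` with the same factor `g` and
`r₁ s₁ = r₂ s₂` with `s₁ ≠ 0`, then `a₁ = (e^{c₁ - c₂} (s₂ / s₁)) a₂`. -/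
theorem gauge_algebra {a₁ a₂ c₁ c₂ r₁ r₂ g s₁ s₂ : ℝ} (h₁ : a₁ = Real.exp c₁ * r₁ * g)
    (h₂ : a₂ = Real.exp c₂ * r₂ * g) (hs₁ : s₁ ≠ 0) (hr : r₁ * s₁ = r₂ * s₂) :
    a₁ = Real.exp (c₁ - c₂) * (s₂ / s₁) * a₂ := by
  have hr₁ : r₁ = r₂ * s₂ / s₁ := by rw [eq_div_iff hs₁]; exact hr
  have he₂ : Real.exp c₂ ≠ 0 := (Real.exp_pos c₂).ne'
  rw [h₁, h₂, hr₁, Real.exp_sub]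
  field_simp

/-- **STUB 2 of the line `count-sufficiency-reduction` — ACTIVITY GAUGE (statics).** For the two
canonical hard-sphere gases of the crux (common diameters `hsDiameter σ₁ N`; `N + 1` resp. `n₂ N`
spheres, `n₂ N ε_N³ → σ₂³`; one-body profiles `(a₁, u₁, θ₁)`, `(a₂, u₂, θ₂)`), below the minimum of
the two thresholds of `NearConstantShortTimeHL.staticLLN_explicit`: if the time-`0` empirical
fields satisfy laws of large numbers towards continuous `ρ₁`, `ρ₂` with `ρ₁ σ₁³ = ρ₂ σ₂³` on
`B(x₀, R)`, then `a₁ = λ a₂` on `B(x₀, R)` for a constant `λ > 0`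
(`λ = e^{c₁ - c₂} (σ₂ / σ₁)³`). The static LLN with activity inversion identifies `ρᵢ` with the
inverted densities `ρaᵢ` (`density_eq_of_llnAt`), and `aᵢ = e^{cᵢ} ρaᵢ e^{g(ρaᵢ σᵢ³)}` with the
same `g`-argument on the ball (`gauge_algebra`). -/
theorem stub_activityGauge :
    ∀ (a₁ θ₁ a₂ θ₂ : T3 → ℝ) (u₁ u₂ : T3 → V3), Continuous a₁ → Continuous θ₁ → Continuous u₁ →
      Continuous a₂ → Continuous θ₂ → Continuous u₂ → (∀ x, 0 < a₁ x) → (∀ x, 0 < θ₁ x) →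
      (∀ x, 0 < a₂ x) → (∀ x, 0 < θ₂ x) →
    ∃ σ₀ : ℝ, 0 < σ₀ ∧ ∀ (σ₁ σ₂ : ℝ), 0 < σ₁ → σ₁ < σ₀ → 0 < σ₂ → σ₂ < σ₀ →
    ∀ n₂ : ℕ → ℕ, Tendsto (fun N => (n₂ N : ℝ) * hsDiameter σ₁ N ^ 3) atTop (𝓝 (σ₂ ^ 3)) →
    ∀ (Φ₁ : (N : ℕ) → HardSphereFlow G3 (hsDiameter σ₁ N) (N + 1))
      (Φ₂ : (N : ℕ) → HardSphereFlow G3 (hsDiameter σ₁ N) (n₂ N)),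
    (∀ N, IsProbabilityMeasure (localGibbsLaw σ₁ a₁ u₁ θ₁ N (Φ₁ N))) →
    (∀ N, IsProbabilityMeasure (particleLaw (Φ₂ N)
      (canonicalDensity G3 (hsDiameter σ₁ N) (n₂ N) (localGibbsProfile a₂ u₂ θ₂)))) →
    ∀ (ρ₁ Θ₁ ρ₂ Θ₂ : T3 → ℝ) (U₁ U₂ : T3 → V3), Continuous ρ₁ → Continuous ρ₂ →
    LLNAt (fun N => N + 1) (fun N => localGibbsLaw σ₁ a₁ u₁ θ₁ N (Φ₁ N)) Φ₁ ρ₁ U₁ Θ₁ 0 →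
    LLNAt n₂ (fun N => particleLaw (Φ₂ N)
      (canonicalDensity G3 (hsDiameter σ₁ N) (n₂ N) (localGibbsProfile a₂ u₂ θ₂))) Φ₂
      ρ₂ U₂ Θ₂ 0 →
    ∀ (x₀ : T3) (R : ℝ),
      (∀ x, Torus.euclidDist x x₀ < R → ρ₁ x * σ₁ ^ 3 = ρ₂ x * σ₂ ^ 3) →
    ∃ lam : ℝ, 0 < lam ∧ ∀ x, Torus.euclidDist x x₀ < R → a₁ x = lam * a₂ x := by
  intro a₁ θ₁ a₂ θ₂ u₁ u₂ ha₁ hθ₁ hu₁ ha₂ hθ₂ hu₂ ha₁0 hθ₁0 ha₂0 hθ₂0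
  obtain ⟨s₁, hs₁, H₁⟩ :=
    NearConstantShortTimeHL.staticLLN_explicit a₁ θ₁ u₁ ha₁ hθ₁ hu₁ ha₁0 hθ₁0
  obtain ⟨s₂, hs₂, H₂⟩ :=
    NearConstantShortTimeHL.staticLLN_explicit a₂ θ₂ u₂ ha₂ hθ₂ hu₂ ha₂0 hθ₂0
  refine ⟨min s₁ s₂, lt_min hs₁ hs₂, ?_⟩
  intro σ₁ σ₂ hσ₁ hσ₁' hσ₂ hσ₂' n₂ hn₂ Φ₁ Φ₂ hP₁ hP₂ ρ₁ Θ₁ ρ₂ Θ₂ U₁ U₂ hρ₁ hρ₂ hL₁ hL₂ x₀ R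
    hagree
  obtain ⟨ρa₁, hρa₁c, hρa₁0, -, ⟨c₁, hc₁⟩, K₁⟩ := H₁ σ₁ hσ₁ (hσ₁'.trans_le (min_le_left _ _))
  obtain ⟨ρa₂, hρa₂c, hρa₂0, -, ⟨c₂, hc₂⟩, K₂⟩ := H₂ σ₂ hσ₂ (hσ₂'.trans_le (min_le_right _ _))
  -- the common admissible family of diameters `ε_N = hsDiameter σ₁ N`
  have hε : ∀ N, 0 < hsDiameter σ₁ N := hsDiameter_pos hσ₁
  have hε0 : Tendsto (hsDiameter σ₁) atTop (𝓝 0) := tendsto_hsDiameter σ₁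
  have hn₁ : Tendsto (fun N : ℕ => (((fun N : ℕ => N + 1) N : ℕ) : ℝ) * hsDiameter σ₁ N ^ 3) atTop
      (𝓝 (σ₁ ^ 3)) :=
    tendsto_const_nhds.congr fun N => (succ_mul_hsDiameter_pow_three σ₁ N).symm
  -- the static laws of large numbers of the two gases, towards the inverted densities
  have K₁' := K₁ (hsDiameter σ₁) (fun N => N + 1) hε hε0 hn₁ Φ₁ hP₁
  have K₂' := K₂ (hsDiameter σ₁) n₂ hε hε0 hn₂ Φ₂ hP₂
  -- identification of the hypothesised limit densities with the inverted densities
  have hρ₁eq : ∀ x, ρ₁ x = ρa₁ x :=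
    density_eq_of_llnAt hP₁ hρ₁ hρa₁c hL₁ fun χ hχ δ hδ => (K₁' χ hχ δ hδ).1
  have hρ₂eq : ∀ x, ρ₂ x = ρa₂ x :=
    density_eq_of_llnAt hP₂ hρ₂ hρa₂c hL₂ fun χ hχ δ hδ => (K₂' χ hχ δ hδ).1
  -- the gauge constant
  refine ⟨Real.exp (c₁ - c₂) * (σ₂ ^ 3 / σ₁ ^ 3), by positivity, fun x hx => ?_⟩
  have hag : ρa₁ x * σ₁ ^ 3 = ρa₂ x * σ₂ ^ 3 := by rw [← hρ₁eq x, ← hρ₂eq x]; exact hagree x hx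
  have h₁ := hc₁ x
  rw [hag] at h₁
  exact gauge_algebra h₁ (hc₂ x) (pow_pos hσ₁ 3).ne' hag

end

end Summit.AtomisticToContinuum.HydrodynamicLimit.Theorems.LightConeInLawCSR
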